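import Mathlib
import HarnessLib
import Summits.Langlands.Langlands.Theses.SkinnerWilesDefectOne
import Summits.Langlands.Langlands.Theorems.SkinnerWilesDefectOneEisensteinProModularSeedRestrictTwistGaloisPackageAux
import Summits.Langlands.Langlands.Theorems.SkinnerWilesDefectOneFiveIsogenyEllipticCurvesIntegralFrame
import Literature.NumberTheory.GaloisRepresentations.AbsGaloisOuterConj
import Literature.NumberTheory.GaloisRepresentations.SorensenPatching

/-!
# Item `SeedOfQuadraticBaseChange` (stmt-Langlands-15158, route `SkinnerWilesDefectOne`):
# what a twisted base change can seed — the invariant/anti-invariant dichotomy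

Why the item's hypothesis `QuadraticBaseChangeGalois` is idle on the heart.  Every seed the line
`descend-raise-basechange` (and any use of quadratic base change) produces has the shape
`r = ν ⊗ ρ'|_{Γ_F}` — the restriction of a continuous `ρ' : Γ_ℚ → GL₂(ℚ̄_p)` along
`res = absGaloisRestrict ℚ F`, twisted by a unit-valued character `ν` of `Γ_F` (stubs S3-Nu/S4 of the
line, `(r σ) = ν(σ) • ρ'(σ|_ℚ)`).  For such `r` with a residually upper-triangular integral model `r₀`
(residual diagonal `(χ̄_a, χ̄_b)`), and any `τ ∈ Γ_ℚ`, conjugation gives the EXACT identity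
`r(θ_τ σ) = (ν(θ_τ σ)/ν(σ)) · ρ'(τ) r(σ) ρ'(τ)⁻¹`, hence equal characteristic polynomials up to the
unit scalar `w = ν^τ/ν`; reducing mod `𝔪`, `{χ̄_a^τ, χ̄_b^τ} = {w̄ χ̄_a, w̄ χ̄_b}` pointwise, and since a
group is not the union of two proper subgroups this holds globally in one of the two orders:

* `ratio_dichotomy_of_restrictTwist` — EITHER the residual ratio `ψ̄ = χ̄_b/χ̄_a` of `r₀` is
  `θ_τ`-INVARIANT (`(r₀σ')₁₁(r₀σ)₀₀ ≡ (r₀σ')₀₀(r₀σ)₁₁` whenever `res σ' = τ res σ τ⁻¹`) OR it is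
  `θ_τ`-ANTI-INVARIANT (`ψ̄(σ') = ψ̄(σ)⁻¹`: `(r₀σ')₁₁(r₀σ)₁₁ ≡ (r₀σ')₀₀(r₀σ)₀₀`);
* `ratio_dichotomy_of_seedByRestrictTwist` — the same for the datum `ρ₀` itself when `(r, r₀)` is a
  seed FOR `ρ₀` (same ordered residual diagonal, the seed crux's congruence clause).

Consequently a residual pair whose ratio is moved by complex conjugation to anything other than its
inverse is out of reach of every base-change-and-twist construction, whatever the local conditions;
the anti-invariant pairs (`ψ̄^c = ψ̄⁻¹ ≠ ψ̄`, the `F`-dihedral residual type) are excluded from the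
Skinner–Wiles sector by the orientation/distinguishedness clause (lead c1's exhaustion note; not
formalised here).  Companion of `…SeedOfQuadraticBaseChangeDescent{Aux,}` (descended ⟺ invariant).
-/

set_option linter.dupNamespace false -- project-wide option (lakefile weak.linter.dupNamespace); `Summit.Langlands.Langlands` is the mandated namespace

noncomputable section

namespace Summit.Langlands.Langlands.Theorems.SkinnerWilesDefectOne.SeedOfQuadraticBaseChange

open Summit.Langlands.Langlands.Theorems.EisensteinProModularSeed.Negative
  (entry_eq_of_integralModel mem_maximalIdeal_of_v_lt_one sub_mem_maximalIdeal_iff)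
open Summit.Langlands.Langlands.Theorems.FiveIsogenyEllipticCurves (v_lt_one_of_mem_maximalIdeal mem_O_iff)
open Literature.NumberTheory.GaloisRepresentations
open NumberField IsLocalRing Filter Field Topology
open scoped Matrix

/-! ### 1. Two elementary lemmas -/

section Elementary

/-- **Vieta, two by two.**  In a field, if `a' + d' = w (a + d)` and `a' d' = w² a d` then
`(a', d') = (w a, w d)` or `(a', d') = (w d, w a)`: `a'` is a root of `(X - w a)(X - w d)`. [folklore] -/
theorem vieta_two {κ : Type*} [Field κ] {a d a' d' w : κ}
    (hs : a' + d' = w * (a + d)) (hp : a' * d' = w ^ 2 * (a * d)) :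
    (a' = w * a ∧ d' = w * d) ∨ (a' = w * d ∧ d' = w * a) := by
  have hd' : d' = w * (a + d) - a' := by rw [← hs]; ring
  have hroot : (a' - w * a) * (a' - w * d) = 0 := by
    have : (a' - w * a) * (a' - w * d) = a' * a' - a' * (w * (a + d)) + w ^ 2 * (a * d) := by ring
    rw [this, ← hs, ← hp]; ring
  rcases mul_eq_zero.mp hroot with h | h
  · left
    refine ⟨sub_eq_zero.mp h, ?_⟩
    rw [hd', sub_eq_zero.mp h]; ring
  · right
    refine ⟨sub_eq_zero.mp h, ?_⟩
    rw [hd', sub_eq_zero.mp h]; ring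

/-- **A group is not the union of two proper subgroups**: if every element lies in `H₁` or in `H₂`,
then `H₁ = ⊤` or `H₂ = ⊤`. [folklore] -/
theorem forall_mem_or_forall_mem_of_forall_mem_or {G : Type*} [Group G] {H₁ H₂ : Subgroup G}
    (h : ∀ g, g ∈ H₁ ∨ g ∈ H₂) : (∀ g, g ∈ H₁) ∨ (∀ g, g ∈ H₂) := by
  by_contra hcon
  push Not at hcon
  obtain ⟨⟨x, hx⟩, ⟨y, hy⟩⟩ := hcon
  have hx₂ : x ∈ H₂ := (h x).resolve_left hx
  have hy₁ : y ∈ H₁ := (h y).resolve_right hy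
  rcases h (x * y) with hxy | hxy
  · exact hx (by simpa using H₁.mul_mem hxy (H₁.inv_mem hy₁))
  · exact hy (by simpa using H₂.mul_mem (H₂.inv_mem hx₂) hxy)

end Elementary

/-! ### 2. Unit-valued characters take values in `Oˣ` -/

section UnitValued

variable {p : ℕ} [Fact p.Prime] {O : ValuationSubring (PadicAlgCl p)} {G : Type*} [Group G]

/-- A unit-valued character `χ : G → ℚ̄_pˣ` (`‖χ(g)‖ = 1`) factors through `Oˣ`, `O = 𝒪_{ℚ̄_p}`.
[folklore] -/
theorem exists_unitsHom_of_unitValued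
    (hO : O = (Valued.v : Valuation (PadicAlgCl p) NNReal).valuationSubring)
    (χ : G →* (PadicAlgCl p)ˣ) (hχ : ∀ g, Valued.v ((χ g : (PadicAlgCl p)ˣ) : PadicAlgCl p) = 1) :
    ∃ χ₀ : G →* Oˣ, ∀ g, ((χ₀ g : O) : PadicAlgCl p) = χ g := by
  have hmem : ∀ g, ((χ g : (PadicAlgCl p)ˣ) : PadicAlgCl p) ∈ O := fun g => by
    rw [mem_O_iff hO, hχ g]
  let f : G → Oˣ := fun g =>
    ⟨⟨(χ g : PadicAlgCl p), hmem g⟩, ⟨(χ g⁻¹ : PadicAlgCl p), hmem g⁻¹⟩,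
      Subtype.ext (by push_cast; rw [← Units.val_mul, ← map_mul, mul_inv_cancel, map_one, Units.val_one]),
      Subtype.ext (by push_cast; rw [← Units.val_mul, ← map_mul, inv_mul_cancel, map_one, Units.val_one])⟩
  have hf : ∀ g, ((f g : O) : PadicAlgCl p) = χ g := fun g => rfl
  refine ⟨{ toFun := f, map_one' := ?_, map_mul' := fun g g' => ?_ }, hf⟩
  · exact Units.ext (Subtype.ext (by rw [hf, map_one, Units.val_one]; rfl))
  · refine Units.ext (Subtype.ext ?_)
    change ((f (g * g') : O) : PadicAlgCl p) = ((f g : O) : PadicAlgCl p) * ((f g' : O) : PadicAlgCl p)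
    rw [hf, hf, hf, map_mul, Units.val_mul]

end UnitValued

/-! ### 3. The dichotomy -/

section Dichotomy

variable {F : Type} [Field F] [NumberField F] {p : ℕ} [Fact p.Prime]
  {O : ValuationSubring (PadicAlgCl p)}

/-- **What a twisted base change can seed: the invariant/anti-invariant dichotomy.**  Let
`ρ' : Γ_ℚ → GL₂(ℚ̄_p)` be continuous, `ν : Γ_F → ℚ̄_pˣ` unit-valued, `r = ν ⊗ ρ'|_{Γ_F}`
(`(r σ) = ν(σ) • ρ'(res σ)`) with a residually upper-triangular integral model `r₀` over
`O = 𝒪_{ℚ̄_p}`, and `τ ∈ Γ_ℚ`.  Then EITHER for all `σ, σ'` with `res σ' = τ res σ τ⁻¹` the residual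
ratio is preserved, `(r₀σ')₁₁(r₀σ)₀₀ ≡ (r₀σ')₀₀(r₀σ)₁₁ (mod 𝔪)`, OR for all such pairs it is inverted,
`(r₀σ')₁₁(r₀σ)₁₁ ≡ (r₀σ')₀₀(r₀σ)₀₀ (mod 𝔪)`.  Proof: `r(σ') = w(σ) · ρ'(τ) r(σ) ρ'(τ)⁻¹` with the unit
`w = ν(σ')/ν(σ)`, so trace and determinant of `r₀(σ')` are `w`, `w²` times those of `r₀(σ)`; mod `𝔪`
Vieta gives `{ā', d̄'} = {w̄ā, w̄d̄}` for each `σ`, and the two alternatives cut `Γ_F` into two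
subgroups (kernels of `χ̄_a^τ/(w̄χ̄_a)` and `χ̄_a^τ/(w̄χ̄_b)`), one of which is everything. [folklore] -/
theorem ratio_dichotomy_of_restrictTwist (hdeg : Module.finrank ℚ F = 2)
    (hO : O = (Valued.v : Valuation (PadicAlgCl p) NNReal).valuationSubring)
    (ρ' : FramedGaloisRep ℚ (PadicAlgCl p) 2) (ν : absoluteGaloisGroup F →ₜ* (PadicAlgCl p)ˣ)
    (hν : ∀ σ, Valued.v ((ν σ : (PadicAlgCl p)ˣ) : PadicAlgCl p) = 1)
    (r : FramedGaloisRep F (PadicAlgCl p) 2)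
    (hr : ∀ σ, (r σ).val = ((ν σ : (PadicAlgCl p)ˣ) : PadicAlgCl p) • (ρ' (absGaloisRestrict ℚ F σ)).val)
    {r₀ : absoluteGaloisGroup F →* Matrix.GeneralLinearGroup (Fin 2) O}
    (hmod : r.HasUpperTriangularIntegralModel r₀) (τ : absoluteGaloisGroup ℚ) :
    (∀ σ σ' : absoluteGaloisGroup F,
        absGaloisRestrict ℚ F σ' = τ * absGaloisRestrict ℚ F σ * τ⁻¹ →
        ((r₀ σ').val 1 1 * (r₀ σ).val 0 0 - (r₀ σ').val 0 0 * (r₀ σ).val 1 1 : O) ∈ maximalIdeal O) ∨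
    (∀ σ σ' : absoluteGaloisGroup F,
        absGaloisRestrict ℚ F σ' = τ * absGaloisRestrict ℚ F σ * τ⁻¹ →
        ((r₀ σ').val 1 1 * (r₀ σ).val 1 1 - (r₀ σ').val 0 0 * (r₀ σ).val 0 0 : O) ∈ maximalIdeal O) := by
  classical
  haveI : Algebra.IsQuadraticExtension ℚ F := ⟨hdeg⟩
  haveI : IsGalois ℚ F := inferInstance
  set θ := absGaloisOuterConj ℚ F τ with hθ_def
  have hθ : ∀ σ, absGaloisRestrict ℚ F (θ σ) = τ * absGaloisRestrict ℚ F σ * τ⁻¹ :=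
    absGaloisRestrict_absGaloisOuterConj ℚ F τ
  have hσ' : ∀ σ σ' : absoluteGaloisGroup F,
      absGaloisRestrict ℚ F σ' = τ * absGaloisRestrict ℚ F σ * τ⁻¹ → σ' = θ σ := fun σ σ' h =>
    absGaloisRestrict_injective ℚ F (by rw [h, hθ])
  -- the unit scalar `w = ν^τ / ν`, through `Oˣ`
  set wχ : absoluteGaloisGroup F →* (PadicAlgCl p)ˣ := ν.toMonoidHom.comp θ.toMonoidHom / ν.toMonoidHom
    with hwχ_def
  have hwχ : ∀ σ, wχ σ = ν (θ σ) / ν σ := fun σ => rfl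
  have hwχ_v : ∀ σ, Valued.v ((wχ σ : (PadicAlgCl p)ˣ) : PadicAlgCl p) = 1 := fun σ => by
    rw [hwχ, Units.val_div_eq_div_val, map_div₀, hν, hν, div_one]
  obtain ⟨w, hw⟩ := exists_unitsHom_of_unitValued hO wχ hwχ_v
  -- the exact conjugation identity and its trace/determinant
  have hconj : ∀ σ, (r (θ σ)).val =
      ((wχ σ : (PadicAlgCl p)ˣ) : PadicAlgCl p) •
        ((ρ' τ).val * (r σ).val * ((ρ' τ)⁻¹ : GL (Fin 2) (PadicAlgCl p)).val) := by
    intro σ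
    have h1 := hr (θ σ)
    rw [hθ, map_mul, map_mul, map_inv, Units.val_mul, Units.val_mul] at h1
    have h2 : (ρ' (absGaloisRestrict ℚ F σ)).val =
        ((ν σ : (PadicAlgCl p)ˣ) : PadicAlgCl p)⁻¹ • (r σ).val := by
      rw [hr σ, smul_smul, inv_mul_cancel₀ (Units.ne_zero _), one_smul]
    rw [h1, h2, hwχ, Units.val_div_eq_div_val, div_eq_mul_inv, ← smul_smul, Matrix.mul_smul,
      Matrix.smul_mul]
  have htrace : ∀ σ, ((r₀ (θ σ)).val 0 0 + (r₀ (θ σ)).val 1 1 : O) =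
      (w σ : O) * ((r₀ σ).val 0 0 + (r₀ σ).val 1 1) := by
    intro σ
    apply Subtype.ext
    have ht : Matrix.trace (r (θ σ)).val =
        ((wχ σ : (PadicAlgCl p)ˣ) : PadicAlgCl p) * Matrix.trace (r σ).val := by
      rw [hconj, Matrix.trace_smul, Matrix.trace_mul_cycle, ← Units.val_mul, inv_mul_cancel,
        Units.val_one, one_mul, smul_eq_mul]
    rw [Matrix.trace_fin_two, Matrix.trace_fin_two, entry_eq_of_integralModel hmod,
      entry_eq_of_integralModel hmod, entry_eq_of_integralModel hmod,
      entry_eq_of_integralModel hmod, ← hw] at ht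
    push_cast
    exact ht
  have hdet : ∀ σ, ((r₀ (θ σ)).val 0 0 * (r₀ (θ σ)).val 1 1 - (r₀ (θ σ)).val 0 1 * (r₀ (θ σ)).val 1 0 : O) =
      (w σ : O) ^ 2 * ((r₀ σ).val 0 0 * (r₀ σ).val 1 1 - (r₀ σ).val 0 1 * (r₀ σ).val 1 0) := by
    intro σ
    apply Subtype.ext
    have hd : Matrix.det (r (θ σ)).val =
        ((wχ σ : (PadicAlgCl p)ˣ) : PadicAlgCl p) ^ 2 * Matrix.det (r σ).val := by
      rw [hconj, Matrix.det_smul, Fintype.card_fin, Matrix.det_mul, Matrix.det_mul,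
        mul_right_comm (Matrix.det (ρ' τ).val), ← Matrix.det_mul, ← Units.val_mul, mul_inv_cancel,
        Units.val_one, Matrix.det_one, one_mul]
    rw [Matrix.det_fin_two, Matrix.det_fin_two, entry_eq_of_integralModel hmod,
      entry_eq_of_integralModel hmod, entry_eq_of_integralModel hmod,
      entry_eq_of_integralModel hmod, entry_eq_of_integralModel hmod,
      entry_eq_of_integralModel hmod, entry_eq_of_integralModel hmod,
      entry_eq_of_integralModel hmod, ← hw] at hd
    push_cast
    exact hd
  -- reduction mod `𝔪`: the residual diagonal characters and `w̄`
  set χa : absoluteGaloisGroup F →* (ResidueField O)ˣ := (hmod.2.residualChar 0).toHomUnits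
    with hχa_def
  set χb : absoluteGaloisGroup F →* (ResidueField O)ˣ := (hmod.2.residualChar 1).toHomUnits
    with hχb_def
  have hχa : ∀ g, ((χa g : (ResidueField O)ˣ) : ResidueField O) = residue O ((r₀ g).val 0 0) :=
    fun g => rfl
  have hχb : ∀ g, ((χb g : (ResidueField O)ˣ) : ResidueField O) = residue O ((r₀ g).val 1 1) :=
    fun g => rfl
  set wbar : absoluteGaloisGroup F →* (ResidueField O)ˣ := (Units.map (residue O).toMonoidHom).comp w
    with hwbar_def
  have hwbar : ∀ σ, ((wbar σ : (ResidueField O)ˣ) : ResidueField O) = residue O (w σ : O) := fun σ => rfl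
  have hlow : ∀ g, residue O ((r₀ g).val 1 0) = 0 := fun g =>
    (residue_eq_zero_iff _).mpr ((isResiduallyUpperTriangular_two_iff r₀).mp hmod.2 g)
  -- pointwise Vieta
  have hvieta : ∀ σ,
      (χa (θ σ) = wbar σ * χa σ ∧ χb (θ σ) = wbar σ * χb σ) ∨
        (χa (θ σ) = wbar σ * χb σ ∧ χb (θ σ) = wbar σ * χa σ) := by
    intro σ
    have hs : ((χa (θ σ) : (ResidueField O)ˣ) : ResidueField O) + χb (θ σ) =
        (wbar σ : ResidueField O) * ((χa σ : ResidueField O) + χb σ) := by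
      rw [hχa, hχb, hχa, hχb, hwbar, ← map_add, ← map_add, ← map_mul, htrace]
    have hpr : ((χa (θ σ) : (ResidueField O)ˣ) : ResidueField O) * χb (θ σ) =
        (wbar σ : ResidueField O) ^ 2 * ((χa σ : ResidueField O) * χb σ) := by
      have h := congrArg (residue O) (hdet σ)
      rw [map_sub, map_mul, map_mul, hlow, mul_zero, sub_zero, map_mul, map_pow, map_sub, map_mul,
        map_mul, hlow, mul_zero, sub_zero] at h
      rw [hχa, hχb, hχa, hχb, hwbar]
      exact h
    rcases vieta_two hs hpr with ⟨h1, h2⟩ | ⟨h1, h2⟩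
    · exact Or.inl ⟨Units.ext h1, Units.ext h2⟩
    · exact Or.inr ⟨Units.ext h1, Units.ext h2⟩
  -- the two alternatives are subgroups; one of them is everything
  set H₁ : Subgroup (absoluteGaloisGroup F) := (χa.comp θ.toMonoidHom / (wbar * χa)).ker with hH₁
  set H₂ : Subgroup (absoluteGaloisGroup F) := (χa.comp θ.toMonoidHom / (wbar * χb)).ker with hH₂
  have hmem₁ : ∀ σ, σ ∈ H₁ ↔ χa (θ σ) = wbar σ * χa σ := fun σ => by
    rw [hH₁, MonoidHom.mem_ker, MonoidHom.div_apply, div_eq_one, MonoidHom.mul_apply]; rfl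
  have hmem₂ : ∀ σ, σ ∈ H₂ ↔ χa (θ σ) = wbar σ * χb σ := fun σ => by
    rw [hH₂, MonoidHom.mem_ker, MonoidHom.div_apply, div_eq_one, MonoidHom.mul_apply]; rfl
  have hall : ∀ σ, σ ∈ H₁ ∨ σ ∈ H₂ := fun σ => by
    rcases hvieta σ with ⟨h1, -⟩ | ⟨h1, -⟩
    · exact Or.inl ((hmem₁ σ).mpr h1)
    · exact Or.inr ((hmem₂ σ).mpr h1)
  -- translation of the conclusions
  have keyA : ∀ σ, χa (θ σ) = wbar σ * χa σ → χb (θ σ) = wbar σ * χb σ →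
      ((r₀ (θ σ)).val 1 1 * (r₀ σ).val 0 0 - (r₀ (θ σ)).val 0 0 * (r₀ σ).val 1 1 : O) ∈ maximalIdeal O := by
    intro σ h1 h2
    rw [← residue_eq_zero_iff, map_sub, map_mul, map_mul, sub_eq_zero, ← hχa, ← hχb, ← hχa, ← hχb,
      ← Units.val_mul, ← Units.val_mul, Units.val_injective.eq_iff, h1, h2]
    exact mul_right_comm _ _ _
  have keyB : ∀ σ, χa (θ σ) = wbar σ * χb σ → χb (θ σ) = wbar σ * χa σ →
      ((r₀ (θ σ)).val 1 1 * (r₀ σ).val 1 1 - (r₀ (θ σ)).val 0 0 * (r₀ σ).val 0 0 : O) ∈ maximalIdeal O := by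
    intro σ h1 h2
    rw [← residue_eq_zero_iff, map_sub, map_mul, map_mul, sub_eq_zero, ← hχa, ← hχb, ← hχa, ← hχb,
      ← Units.val_mul, ← Units.val_mul, Units.val_injective.eq_iff, h1, h2]
    exact mul_right_comm _ _ _
  rcases forall_mem_or_forall_mem_of_forall_mem_or hall with hA | hB
  · left
    intro σ σ₁ h
    rw [hσ' σ σ₁ h]
    have h1 : χa (θ σ) = wbar σ * χa σ := (hmem₁ σ).mp (hA σ)
    rcases hvieta σ with ⟨-, h2⟩ | ⟨h1', h2'⟩
    · exact keyA σ h1 h2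
    · -- both alternatives hold: then `χa σ = χb σ` and we are still in case A
      have hab : χa σ = χb σ := mul_left_cancel (h1.symm.trans h1')
      exact keyA σ h1 (by rw [h2', hab])
  · right
    intro σ σ₁ h
    rw [hσ' σ σ₁ h]
    have h1 : χa (θ σ) = wbar σ * χb σ := (hmem₂ σ).mp (hB σ)
    rcases hvieta σ with ⟨h1', h2'⟩ | ⟨-, h2⟩
    · have hab : χb σ = χa σ := mul_left_cancel (h1.symm.trans h1')
      exact keyB σ h1 (by rw [h2', hab])
    · exact keyB σ h1 h2

/-- **The dichotomy for the datum.**  If `(r, r₀)` as above is a seed FOR `ρ₀` — `r₀` has the same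
ordered residual diagonal as `ρ₀` (the seed crux's clause `(r₀ g)ᵢᵢ ≡ (ρ₀ g)ᵢᵢ (mod 𝔪)`) — then for
every `τ ∈ Γ_ℚ` the residual ratio of `ρ₀` is either `θ_τ`-invariant or `θ_τ`-anti-invariant.  So a
pair whose ratio is moved by some `τ` to anything but its inverse is never seeded by a twisted base
change from `ℚ` (whatever quadratic base change supplies). [folklore] -/
theorem ratio_dichotomy_of_seedByRestrictTwist (hdeg : Module.finrank ℚ F = 2)
    (hO : O = (Valued.v : Valuation (PadicAlgCl p) NNReal).valuationSubring)
    (ρ' : FramedGaloisRep ℚ (PadicAlgCl p) 2) (ν : absoluteGaloisGroup F →ₜ* (PadicAlgCl p)ˣ)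
    (hν : ∀ σ, Valued.v ((ν σ : (PadicAlgCl p)ˣ) : PadicAlgCl p) = 1)
    (r : FramedGaloisRep F (PadicAlgCl p) 2)
    (hr : ∀ σ, (r σ).val = ((ν σ : (PadicAlgCl p)ˣ) : PadicAlgCl p) • (ρ' (absGaloisRestrict ℚ F σ)).val)
    {r₀ ρ₀ : absoluteGaloisGroup F →* Matrix.GeneralLinearGroup (Fin 2) O}
    (hmod : r.HasUpperTriangularIntegralModel r₀)
    (hdiag : ∀ g, ((r₀ g).val 0 0 - (ρ₀ g).val 0 0 : O) ∈ maximalIdeal O ∧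
      ((r₀ g).val 1 1 - (ρ₀ g).val 1 1 : O) ∈ maximalIdeal O)
    (τ : absoluteGaloisGroup ℚ) :
    (∀ σ σ' : absoluteGaloisGroup F,
        absGaloisRestrict ℚ F σ' = τ * absGaloisRestrict ℚ F σ * τ⁻¹ →
        ((ρ₀ σ').val 1 1 * (ρ₀ σ).val 0 0 - (ρ₀ σ').val 0 0 * (ρ₀ σ).val 1 1 : O) ∈ maximalIdeal O) ∨
    (∀ σ σ' : absoluteGaloisGroup F,
        absGaloisRestrict ℚ F σ' = τ * absGaloisRestrict ℚ F σ * τ⁻¹ →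
        ((ρ₀ σ').val 1 1 * (ρ₀ σ).val 1 1 - (ρ₀ σ').val 0 0 * (ρ₀ σ).val 0 0 : O) ∈ maximalIdeal O) := by
  have hres : ∀ g (i : Fin 2), i = 0 ∨ i = 1 →
      residue O ((r₀ g).val i i) = residue O ((ρ₀ g).val i i) := by
    rintro g i (rfl | rfl)
    · exact sub_mem_maximalIdeal_iff.mp (hdiag g).1
    · exact sub_mem_maximalIdeal_iff.mp (hdiag g).2
  have transfer : ∀ (σ σ' : absoluteGaloisGroup F) (i j : Fin 2), (i = 0 ∨ i = 1) → (j = 0 ∨ j = 1) →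
      (((r₀ σ').val 1 1 * (r₀ σ).val i i - (r₀ σ').val 0 0 * (r₀ σ).val j j : O) ∈ maximalIdeal O ↔
        ((ρ₀ σ').val 1 1 * (ρ₀ σ).val i i - (ρ₀ σ').val 0 0 * (ρ₀ σ).val j j : O) ∈ maximalIdeal O) := by
    intro σ σ' i j hi hj
    rw [← residue_eq_zero_iff, ← residue_eq_zero_iff, map_sub, map_sub, map_mul, map_mul, map_mul,
      map_mul, hres σ' 1 (Or.inr rfl), hres σ i hi, hres σ' 0 (Or.inl rfl), hres σ j hj]
  rcases ratio_dichotomy_of_restrictTwist hdeg hO ρ' ν hν r hr hmod τ with hA | hB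
  · exact Or.inl fun σ σ' h => (transfer σ σ' 0 1 (Or.inl rfl) (Or.inr rfl)).mp (hA σ σ' h)
  · exact Or.inr fun σ σ' h => (transfer σ σ' 1 0 (Or.inr rfl) (Or.inl rfl)).mp (hB σ σ' h)

/-- **Generic pairs are out of reach of base change and twist.**  If the residual ratio of `ρ₀` is,
for one `τ ∈ Γ_ℚ`, NEITHER `θ_τ`-invariant (witness `σ₁, σ₁'`) NOR `θ_τ`-anti-invariant (witness
`σ₂, σ₂'`), then no twisted restriction `r = ν ⊗ ρ'|_{Γ_F}` of a continuous `ρ' : Γ_ℚ → GL₂(ℚ̄_p)`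
admits a residually upper-triangular integral model with the ordered residual diagonal of `ρ₀` —
whatever `ρ'`, `ν` and the local behaviour.  This is the theorem-grade half of "quadratic base change
is idle on the heart of the seed": the item's hypothesis `QuadraticBaseChangeGalois` only ever
supplies such `r`. [folklore] -/
theorem not_seedByRestrictTwist_of_generic (hdeg : Module.finrank ℚ F = 2)
    (hO : O = (Valued.v : Valuation (PadicAlgCl p) NNReal).valuationSubring)
    {ρ₀ : absoluteGaloisGroup F →* Matrix.GeneralLinearGroup (Fin 2) O} (τ : absoluteGaloisGroup ℚ)
    (σ₁ σ₁' : absoluteGaloisGroup F)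
    (h₁ : absGaloisRestrict ℚ F σ₁' = τ * absGaloisRestrict ℚ F σ₁ * τ⁻¹)
    (hne₁ : ((ρ₀ σ₁').val 1 1 * (ρ₀ σ₁).val 0 0 - (ρ₀ σ₁').val 0 0 * (ρ₀ σ₁).val 1 1 : O) ∉
      maximalIdeal O)
    (σ₂ σ₂' : absoluteGaloisGroup F)
    (h₂ : absGaloisRestrict ℚ F σ₂' = τ * absGaloisRestrict ℚ F σ₂ * τ⁻¹)
    (hne₂ : ((ρ₀ σ₂').val 1 1 * (ρ₀ σ₂).val 1 1 - (ρ₀ σ₂').val 0 0 * (ρ₀ σ₂).val 0 0 : O) ∉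
      maximalIdeal O)
    (ρ' : FramedGaloisRep ℚ (PadicAlgCl p) 2) (ν : absoluteGaloisGroup F →ₜ* (PadicAlgCl p)ˣ)
    (hν : ∀ σ, Valued.v ((ν σ : (PadicAlgCl p)ˣ) : PadicAlgCl p) = 1)
    (r : FramedGaloisRep F (PadicAlgCl p) 2)
    (hr : ∀ σ, (r σ).val = ((ν σ : (PadicAlgCl p)ˣ) : PadicAlgCl p) • (ρ' (absGaloisRestrict ℚ F σ)).val)
    (r₀ : absoluteGaloisGroup F →* Matrix.GeneralLinearGroup (Fin 2) O)
    (hmod : r.HasUpperTriangularIntegralModel r₀) :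
    ¬ (∀ g, ((r₀ g).val 0 0 - (ρ₀ g).val 0 0 : O) ∈ maximalIdeal O ∧
      ((r₀ g).val 1 1 - (ρ₀ g).val 1 1 : O) ∈ maximalIdeal O) := fun hdiag =>
  (ratio_dichotomy_of_seedByRestrictTwist hdeg hO ρ' ν hν r hr hmod hdiag τ).elim
    (fun hA => hne₁ (hA σ₁ σ₁' h₁)) (fun hB => hne₂ (hB σ₂ σ₂' h₂))

end Dichotomy

end Summit.Langlands.Langlands.Theorems.SkinnerWilesDefectOne.SeedOfQuadraticBaseChange

end
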